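import Mathlib
import HarnessLib
import HarnessLib.Audit
import Summits.AtomisticToContinuum.Statement

/-!
Route: SingleThermostatRigidity

CLOSED (retired) 2026-08-15T13:46:37Z by operator:999:1257524 — reason: not-a-thesis: assembly does not conclude the sub-problem Statement — note: D-0027 §2.1 audit (human 2026-08-15: routes that do not decide the summit are removed): the assembly concludes `BoundaryThermalisation`, not the sub-problem statement; a NEW conforming route may be opened from the same idea (generated `closes : … → _root_.FouriersLaw`).. The file is kept as the record of this route; refuted decls are indexed as negative knowledge (`ledger negatives`).

RUNG ROUTE realising idea card single-thermostat-rigidity (a partial-result engine; NOT a proof of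
the conjunct, and no assembly to FouriersLaw is claimed).
X := BoundaryThermalisation: for pinnedChain ω₂ lam β γ (all four > 0) and all FIXED bath
temperatures T_L, T_R > 0, every family (μ_N)_N of weak steady states
(OscillatorChain.IsSteadyState) satisfies, as N → ∞,
  ⟨p_0²⟩_{μ_N} → T_L,  ⟨p²_{N−1}⟩_{μ_N} → T_R,  J̃_N = totalCurrent(μ_N)/(N−1) → 0 :
the end particles thermalise with their own baths and no per-bond current survives — the first
qualitative rung below HasBoundedResponse, open for every deterministic anharmonic chain and FALSE
for the harmonic chain (J̃_N → c_∞·δT > 0, HarmonicChainBallisticFlux, proved in tree).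
It suffices to show (Assembly := NessTightness → HalfLineLimit → SingleThermostatNoFlux →
ExactBalance → BoundaryThermalisation, all decls of this route file):
 • crux SingleThermostatNoFlux (rank 2): every TEMPERED weak-stationary state ν of the HALF-INFINITE
pinned chain on ℕ driven by ONE Langevin bath (temperature T, friction γ) at site 0 has ∫ p_0² dν =
T — equivalently zero energy flux through every bond: the singly-thermostatted half-line admits no
radiating steady state (the boundary-driven, N-free shadow of "not ballistic"; a Liouville-type
rigidity statement);
 • crux NessTightness (rank 3): polynomial site moments of steady states bounded uniformly in N and
in the site;
 • support HalfLineLimit (compactness: along any subsequence on which ⟨p_0²⟩_{μ_N} stays ε away from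
T_L, a tight steady family has a tempered half-line weak-stationary limit state inheriting the
defect) and support ExactBalance (J̃ = γ(T_L − ⟨p_0²⟩) = γ(⟨p²_{N−1}⟩ − T_R), exact for steady
states with moments).
Lean conventions (no new definitions needed; every constant exists): half-line states are
MeasureTheory.Measure (ℕ → ℝ × ℝ); weak stationarity = ∫ (pinnedChain …).generator (k+2) T T (g ∘
castSucc-restriction) (σ|_{0..k+1}) dν = 0 for every k and every smooth compactly supported g on
PhaseSpace (k+1) (the window generator's right-bath term acts on the ignored coordinate k+1 and
vanishes identically, so this is exactly ∫ L_half f dν = 0 on smooth cylinder functions); tempered =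
∀ m, sup_k ∫ (|q_k|^m + |p_k|^m) dν < ∞.
One-line Lean form of X: ∀ ω₂ lam β γ > 0, ∀ T_L T_R > 0, ∀ μ : (N : ℕ) → Measure (PhaseSpace N), (∀
N, (pinnedChain ω₂ lam β γ).IsSteadyState N T_L T_R (μ N)) → Tendsto (N ↦ ∫ (x.2 0)² ∂μ (N+1)) atTop
(𝓝 T_L) ∧ Tendsto (N ↦ ∫ (x.2 (Fin.last N))² ∂μ (N+1)) atTop (𝓝 T_R) ∧ Tendsto (N ↦ totalCurrent (μ
N)/(N−1)) atTop (𝓝 0).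
X does not imply FouriersLaw (no rate; δT fixed rather than δT → 0 first); its role: (a) the
contact-thermalisation input silently needed by the quantitative routes (boundary layers in
FourierGreenKubo.ThermodynamicLimit; contact terms in FeketeResistance / SuperadditiveJunction), (b)
a stand-alone N-free theorem target (NoFlux) that separates ballistic from non-ballistic behaviour
in the boundary-driven setting, as the Drude weight does at equilibrium.

Rationale: WHY THIS LINE. Nobody can prove even J̃_N → 0 for a deterministic anharmonic bulk
(BonettoLebowitzReyBellet2000 §6.3, §9; Bernardin2014 §2). The card's move is to get the qualitative
rung WITHOUT rates, Green–Kubo or hydrodynamics: compactness of the NESS seen FROM the bath (keep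
the bath, send the other end to infinity) + a rigidity theorem for the limit object — the
half-infinite chain with ONE thermostat — in the spirit of Eyink–Lebowitz–Spohn
(EyinkLebowitzSpohn1991: boundary LTE of reservoir-driven lattice gases from uniqueness of the limit
dynamics' stationary states) and Bernardin–Olla (BernardinOlla2011 Thm 3: ⟨p_1²⟩ → T_ℓ for harmonic
chain + flips), transplanted to the deterministic chain. The solved neighbours bracketing the crux:
on the stochastic side the half-line-plus-one-reservoir uniqueness is a discrete Liouville theorem
(symmetric exclusion: invariant measures ↔ bounded harmonic functions, Liggett2005 Ch. VIII Thm
1.44: ρ + c·x bounded ⇒ c = 0 ⇒ zero current); with thermal noise at EVERY site tempered stationary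
states of infinite anharmonic systems are Gibbs (Fritz1986, FritzFunakiLebowitz1994). With noise and
dissipation at ONE site of a conservative bulk nothing is known: that is crux
SingleThermostatNoFlux. Imported areas: infinite-volume weak-stationarity/compactness technology
(LanfordLebowitzLieb1977-style cylinder calculus, in tree as OscillatorChain.generator /
IsTimeInvariant conventions), Liouville/rigidity viewpoint from interacting particle systems
(Liggett2005). No physical analogy is load-bearing; the kinetic picture (AokiLukkarinenSpohn2006)
only informs the failure modes.
RANKED CRUXES.
 2. SingleThermostatNoFlux — the new object. Why it might fail: radiating tempered states could
exist (i) from a hidden conserved charge / ballistic channel exactly as for the harmonic chain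
(SpohnLebowitz1977 current-carrying stationary states; Mazur), (ii) as outgoing low-density
radiation: with κ(T) ∼ (lam T)⁻² (AokiLukkarinenSpohn2006) the macroscopic stationary heat equation
on the half-line admits profiles T(x) ∼ 1/x carrying a constant flux with bounded temperature, so
excluding them at the lattice level needs "a dilute outgoing phonon beam thermalises" (flux ≤ v_max
× energy density forces the far field to keep energy density ≥ J/v_max, where 4-phonon collisions
act) — the near-integrable corner of LowTemperatureWeakAnharmonicity. Incoming radiation (⟨p_0²⟩ >
T) needs an unbounded profile and is excluded by temperedness already at the macroscopic level.
 3. NessTightness — shared in substance with card regular-or-radiating (its NESSBulkRegularity(a))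
and with every boundary-layer argument: no N-uniform a priori estimate for Hamiltonian-bulk NESS
exists (Bernardin2014 §2); CEHR2018/Carmona2007 constants grow with N; stiff pinning heats tails
(Hairer2009) — pinnedChain is the borderline degree 4 = 4 where CEHR's C5 still holds.
SUPPORT (provable, filed typed): HalfLineLimit (Prokhorov on the Polish space (ℝ²)^ℕ +
energy-shell/radial cutoff to test non-compactly-supported cylinder functions + uniform
integrability from 4th moments), ExactBalance (∫ L(p_0²/2 + U(q_0)) = 0 and ∫ L V(q_1 − q_0) = 0
with cutoffs), HarmonicRadiatingState (calibration: for lam = β = 0 a tempered half-line steady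
state with ∫ p_0² ≠ T EXISTS — from the tree's harmonicNESS, HarmonicChainBallisticFlux_holds and
HalfLineLimit — certifying that NoFlux is genuinely anharmonic and that the tempered class does not
exclude currents by itself), SingleThermostatThermalises (the stronger expected form: every momentum
marginal is Maxwellian(T); not load-bearing).
KILL CRITERIA. A tempered weak-stationary state of the anharmonic half-line system with ∫ p_0² ≠ T
(¬SingleThermostatNoFlux) closes the route as refuted and is itself a headline result (a
deterministic anharmonic chain sustaining steady radiation); so does an N-growing site moment in the
NESS (¬NessTightness, energy localisation in the driven chain). A refutation of
HalfLineLimit/ExactBalance can only be a formalisation slip — repair by restate.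
NOT DECOMPOSED YET (earned by splits later): NoFlux into (3a) zero bath dissipation ⇒ Maxwellian
momenta ⇒ Gibbs (unique continuation / Hörmander propagation along the chain in infinite volume) and
(3b) tempered ⇒ zero free-energy influx from infinity (entropy-production bookkeeping for the
half-line: γT·I(ν_{p_0}|Maxwellian) = free-energy flux at infinity); NessTightness into end-window
bounds vs bulk bounds; the linear-response twin of NoFlux (which would feed
SuperadditiveJunction.NonBallistic) is deliberately left to that route.
PRIOR PROGRAMME: docs/m5/inspiration not read (plancard mode; nothing reused).
SOURCES: BonettoLebowitzReyBellet2000 §5.2, §6.3, §9; EyinkLebowitzSpohn1991; BernardinOlla2011 Thm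
3 (arXiv:1105.0493 §7); SpohnLebowitz1977; Liggett2005 Ch. VIII Thm 1.44; Fritz1986;
FritzFunakiLebowitz1994; Bernardin2014 §1–2; LanfordLebowitzLieb1977;
CuneoEckmannHairerReyBellet2018 Thm 2.13 (in tree, proved:
CuneoEckmannHairerReyBellet2018_pinnedChain_holds); EckmannPilletReyBellet1999b; Hairer2009;
HairerMattingly2009; AokiLukkarinenSpohn2006 (3.25)–(3.28); RiederLebowitzLieb1967; Dhar2008 §3;
AokiKusnezov2001 (boundary jumps shrink with N, numerics).

Novelty: Searches (this session + the card's two novelty audits, refs re-checked): `lit search --hybrid`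
("stationary states infinite anharmonic system thermal noise Gibbs tempered Fritz" — books only:
attal2006 LNM1881 Rey-Bellet notes, arous2008), `lit vsearch` (uniqueness of the stationary state of
an infinite anharmonic chain with one Langevin bath — no paper hit; kipnis1999, liggett-type IPS
material), crossref ("semi-infinite anharmonic chain heat bath stationary state uniqueness" — noise
only), `lit galaxy search --star all` ×3 ("semi-infinite anharmonic chain coupled to a heat bath",
"semi-infinite anharmonic chain", "semi-infinite chain of anharmonic oscillators": 0 rows), plus the
audits' crossref ×4, Liggett grep and `lit read` arXiv:1105.0493 p.18. Nearest prior art: (a) the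
SCHEME tightness ⇒ infinite-volume limit at the boundary ⇒ uniqueness of the limit system's
stationary states ⇒ boundary local equilibrium is EyinkLebowitzSpohn1991 (reservoir-driven lattice
gases, rigidity from the Dirichlet form) and BernardinOlla2011 Thm 3 (harmonic chain + velocity
flips: ⟨p_1²⟩ → T_ℓ, ⟨j⟩ → 0); (b) the half-line-plus-one-reservoir uniqueness is a discrete
Liouville theorem on the stochastic side (Liggett2005 Ch. VIII Thm 1.44: bounded harmonic functions
ρ + c·x ⇒ c = 0), and Gibbsianness of tempered stationary states holds with thermal noise at every
site (Fritz1986 doi:10.1007/bf01010903; FritzFunakiLebowitz1994); (c) the failing corner is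
classical: current-carrying stationary s  [refs: 10.1007/bf01010903, 10.1007/bf01614132, 10.1007/bf01010871, 10.1063/1.1571658, 1105.0493, doi:10.1007/bf01010903, doi:10.1007/bf01614132, doi:10.1007/bf01010871, doi:10.1063/1.1571658, EyinkLebowitzSpohn1991, BernardinOlla2011, Liggett2005, Fritz1986, FritzFunakiLebowitz1994, SpohnLebowitz1977]

Barriers (technique_class: single-thermostat-rigidity liouville-uniqueness): technique_class: single-thermostat-rigidity liouville-uniqueness
- Literature.Barriers.AtomisticToContinuum.HasBoundedResponse (FixedLengthNoConductivityControl):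
NOT evaded and not claimed — the route's output BoundaryThermalisation (J̃_N → 0 at fixed δT) is
strictly weaker than HasBoundedResponse (D_N = O(1)); the route escapes the fixed-N trap only in
that its crux is an N-free infinite-volume statement reached by compactness; it is filed openly as a
rung.
- Literature.Barriers.AtomisticToContinuum.MacroErgodicityBarrier: SingleThermostatNoFlux is a
classification-type statement about stationary states of an infinite deterministic system — same
family of difficulty, honestly; but strictly weaker than macro-ergodicity: ONE boundary bath
supplies dissipation, a reference temperature and an entropy-production identity; no translation
invariance, no space-time averages, no one- /two-block estimates, no sector condition (the barrier's
formal kernel concerns the non-gradient method, unused here). The bet is exactly that this weaker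
rigidity is provable where macro-ergodicity is not.
- Literature.Barriers.AtomisticToContinuum.HarmonicChainBallisticFlux (HarmonicCrystalBallistic):
consistent and USED — at lam = β = 0 radiating tempered half-line states exist (support item
HarmonicRadiatingState, provable from the tree's harmonicNESS + HarmonicChainBallisticFlux_holds +
HalfLineLimit), so NoFlux is stated for lam, β > 0 only and no step is anharmonicity-free: the crux
fails exactly

Novelty grade: variant — REVIEW (rreview-3539e784; route already CLOSED retired by operator 13:46Z as a rung/not-a-thesis). Elaborates rc0 (8 typed decls). Checked: IsSteadyState carries IsProbabilityMeasure + integrable currents (no zero-measure/scaling junk in NessTightness/BoundaryThermalisation); window-generator encodi (refuter refuter-rreview-route-HodgeConjecture-Ev-3539e784-0, 2026-08-15T13:59:27Z; prior: EyinkLebowitzSpohn1991, arXiv:1105.0493, doi:10.1007/bf01010903, FritzFunakiLebowitz1994, SpohnLebowitz1977)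

History (route lifecycle, newest last):
- 2026-08-15T13:46:37Z · CLOSED retired — not-a-thesis: assembly does not conclude the sub-problem Statement (operator:999:1257524)

sub-problem: FouriersLaw · status: closed(retired) · opened planner-plancard-AtomisticToContinuum-Fourier-bd64c315-0 2026-08-15T11:14:38Z · rev 0 · ledger route-AtomisticToContinuum-SingleThermostatRigidity
GENERATED by the gate from the ledger (D-0016/17). Provers cite these decls: `theorem foo : Summit.AtomisticToContinuum.FouriersLaw.Theses.SingleThermostatRigidity.<Decl> := …` in Summits/AtomisticToContinuum/FouriersLaw/Theorems/<Name>.lean.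
-/

namespace Summit.AtomisticToContinuum.FouriersLaw.Theses.SingleThermostatRigidity

open scoped BigOperators Topology Manifold Classical MeasureTheory ProbabilityTheory Matrix InnerProductSpace ComplexConjugate ContinuousMap
open Filter Set Function TopologicalSpace MeasureTheory

attribute [summit_statement] _root_.FouriersLaw

/-- item stmt-AtomisticToContinuum-3255 · target · rank 0 · closed · moot by None · by planner
why it might fail: Inherits both cruxes: N-growing boundary moments of the NESS (¬NessTightness) or a radiating tempered state of the anharmonic half-line chain (¬NoFlux: hidden conserved charge, or non-thermalising dilute phonon radiation) break it; exotic non-unique weak steady states (NessUnique open) as well.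
sources: BonettoLebowitzReyBellet2000, BernardinOlla2011, AokiKusnezov2001, RiederLebowitzLieb1967
[target] BOUNDARY THERMALISATION / FIRST RUNG at fixed temperatures: for pinnedChain ω₂ lam β γ (all
> 0), T_L, T_R > 0 and EVERY family (μ_N)_N of weak steady states (IsSteadyState; such families
exist: CuneoEckmannHairerReyBellet2018_pinnedChain_holds + isSteadyState_zero): ⟨p_0²⟩_{μ_{N+1}} →
T_L, ⟨p_N²⟩_{μ_{N+1}} → T_R (site Fin.last N) and J̃_N = totalCurrent(μ_N)/(N−1) → 0 as N → ∞ (N =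
0, 1 give junk 0/finite terms, irrelevant to atTop). Open for every deterministic anharmonic chain;
FALSE for the harmonic chain (J̃_N → c_∞(T_L − T_R), HarmonicChainBallisticFlux_holds). Strictly
weaker than HasBoundedResponse (no rate; δT fixed) — a rung, not the conjunct. Sources:
BonettoLebowitzReyBellet2000 §6.3/§9; BernardinOlla2011 Thm 3 (stochastic precedent);
AokiKusnezov2001 (boundary jumps shrink with N, numerics). -/
@[route_item "route-AtomisticToContinuum-SingleThermostatRigidity"]
def BoundaryThermalisation : Prop :=
  ∀ ω₂ lam β γ : ℝ, 0 < ω₂ → 0 < lam → 0 < β → 0 < γ → ∀ T_L T_R : ℝ, 0 < T_L → 0 < T_R → ∀ μ : (N : ℕ) → MeasureTheory.Measure (Literature.MathematicalPhysics.KineticTheory.HeatConduction.PhaseSpace N), (∀ N, (Literature.MathematicalPhysics.KineticTheory.HeatConduction.pinnedChain ω₂ lam β γ).IsSteadyState N T_L T_R (μ N)) → Filter.Tendsto (fun N : ℕ => ∫ x, (x.2 (0 : Fin (N + 1))) ^ 2 ∂(μ (N + 1))) Filter.atTop (nhds T_L) ∧ Filter.Tendsto (fun N : ℕ => ∫ x,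 (x.2 (Fin.last N)) ^ 2 ∂(μ (N + 1))) Filter.atTop (nhds T_R) ∧ Filter.Tendsto (fun N : ℕ => (Literature.MathematicalPhysics.KineticTheory.HeatConduction.pinnedChain ω₂ lam β γ).totalCurrent (μ N) / ((N : ℝ) - 1)) Filter.atTop (nhds 0)

/-- item stmt-AtomisticToContinuum-3256 · crux · rank 2 · closed · moot by None · by planner
why it might fail: Radiating tempered states may exist: (i) a hidden conserved charge / ballistic channel gives them as in the harmonic case (SpohnLebowitz1977; Mazur); (ii) outgoing low-density radiation: κ∼(lam T)⁻² admits Fourier profiles T(x)∼1/x with constant flux — a dilute outgoing phonon beam must thermalise.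
sources: SpohnLebowitz1977, EyinkLebowitzSpohn1991, BernardinOlla2011, Liggett2005, Fritz1986, FritzFunakiLebowitz1994
[crux] SINGLE-THERMOSTAT NO-FLUX RIGIDITY (the card's Liouville-type crux in its load-bearing form).
Setting: the HALF-INFINITE pinned chain on ℕ (U = ω₂q²/2 + lam q⁴/4, V = r²/2 + βr⁴/4, all
parameters > 0) with ONE Langevin bath (temperature T > 0, friction γ) at site 0 and nothing at
infinity. A probability measure ν on ℕ → ℝ × ℝ is weak-stationary iff ∫ L_half f dν = 0 for every
smooth compactly supported cylinder function f of the sites 0..k, written with the tree's window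
generator: (pinnedChain …).generator (k+2) T T applied to g ∘ (castSucc-restriction) and evaluated
on σ|_{0..k+1} (the window's right-bath term acts on the coordinate k+1 that g ignores, so it
vanishes identically; the Hamiltonian part reproduces the half-line forces on sites ≤ k). ν is
tempered iff every polynomial site moment ∫(|q_k|^m + |p_k|^m) dν is finite and bounded uniformly in
k. CLAIM: every tempered weak-stationary ν has ∫ p_0² dν = T. By the half-line exact balance
(stationarity of the window energies) γ(T − ⟨p_0²⟩_ν) = ⟨j_k⟩_ν for every bond k, so the claim says:
NO RADIATING STATE — the bath neither feeds nor drains a steady energy flux carried to/from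
infinity. True for diffusive media heurist -/
@[route_item "route-AtomisticToContinuum-SingleThermostatRigidity"]
def SingleThermostatNoFlux : Prop :=
  ∀ ω₂ lam β γ : ℝ, 0 < ω₂ → 0 < lam → 0 < β → 0 < γ → ∀ T : ℝ, 0 < T → ∀ ν : MeasureTheory.Measure (ℕ → ℝ × ℝ), (MeasureTheory.IsProbabilityMeasure ν ∧ ∀ (k : ℕ) (g : Literature.MathematicalPhysics.KineticTheory.HeatConduction.PhaseSpace (k + 1) → ℝ), ContDiff ℝ ((⊤ : ℕ∞) : WithTop ℕ∞) g → HasCompactSupport g → ∫ σ, (Literature.MathematicalPhysics.KineticTheory.HeatConduction.pinnedChain ω₂ lam β γ).generator (k + 2) T T (fun y => g (fun i => y.1 (Fin.castSucc i), fun i => y.2 (Fin.castSucc i))) (fun i => (σ (i : ℕ)).1, fun i => (σ (i : ℕ)).2) ∂ν = 0) → (∀ m : ℕ, ∃ C : ℝ, ∀ k : ℕ, MeasureTheory.Integrable (fun σ => |(σ k).1| ^ m + |(σ k).2| ^ m) ν ∧ ∫ σ, (|(σ k).1| ^ m + |(σ k).2| ^ m) ∂ν ≤ C) → ∫ σ,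 (σ 0).2 ^ 2 ∂ν = T

/-- item stmt-AtomisticToContinuum-3257 · crux · rank 3 · closed · moot by None · by planner
why it might fail: No N-uniform a priori bound on NESS moments exists for any Hamiltonian-bulk chain (Bernardin2014 §2: polynomial in N); stiff pinning heats tails / localises energy (Hairer2009, HairerMattingly2009), pinnedChain is the borderline degree 4 = 4; weak steady states might be non-unique (NessUnique open).
sources: Bernardin2014, CuneoEckmannHairerReyBellet2018, Hairer2009, HairerMattingly2009, EckmannPilletReyBellet1999b, BonettoLebowitzReyBellet2000
[crux] N- AND SITE-UNIFORM MOMENT BOUNDS FOR THE NESS: for pinnedChain (all parameters > 0), T_L,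
T_R > 0 and every m there is C = C(ω₂,lam,β,γ,T_L,T_R,m) such that for every N, every weak steady
state μ of the N-chain (IsSteadyState) and every site i: |q_i|^m + |p_i|^m is μ-integrable with ∫ ≤
C. Physically overwhelming (local states between T_R and T_L with Gaussian momentum and e^{-lam
q⁴/4T} position tails) but no N-uniform a priori estimate is known for any Hamiltonian-bulk chain:
the printed Lyapunov bounds (e^{ϑH} ∈ L¹, CuneoEckmannHairerReyBellet2018 Thm 2.13, in tree and
proved for each N) have N-dependent constants. Needed with m = 4 for the compactness step (uniform
integrability of the cubic forces and of p_0²) and with all m to land in the tempered class of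
NoFlux; shared in substance with card regular-or-radiating (NESSBulkRegularity(a)) and with every
boundary-layer argument of FourierGreenKubo.ThermodynamicLimit. Candidate engines: local energy
balance + bath dissipation identities (entropy production = γ Σ_α T_α × relative Fisher information
of the p_α-marginal, EckmannPilletReyBellet1999b; BonettoLebowitzReyBellet2000 §5.2),
maximum-principle statements for kineti -/
@[route_item "route-AtomisticToContinuum-SingleThermostatRigidity"]
def NessTightness : Prop :=
  ∀ ω₂ lam β γ : ℝ, 0 < ω₂ → 0 < lam → 0 < β → 0 < γ → ∀ T_L T_R : ℝ, 0 < T_L → 0 < T_R → ∀ m : ℕ, ∃ C : ℝ, ∀ (N : ℕ) (μ : MeasureTheory.Measure (Literature.MathematicalPhysics.KineticTheory.HeatConduction.PhaseSpace N)), (Literature.MathematicalPhysics.KineticTheory.HeatConduction.pinnedChain ω₂ lam β γ).IsSteadyState N T_L T_R μ → ∀ i : Fin N, MeasureTheory.Integrable (fun x => |x.1 i| ^ m + |x.2 i| ^ m) μ ∧ ∫ x, (|x.1 i| ^ m + |x.2 i| ^ m) ∂μ ≤ C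

/-- item stmt-AtomisticToContinuum-3258 · support · rank 9 · closed · moot by None · by planner
sources: LanfordLebowitzLieb1977, EyinkLebowitzSpohn1991
[support] COMPACTNESS / PASSAGE TO THE HALF-LINE LIMIT (provable; no sign conditions on the
parameters are needed): for any real ω₂ lam β γ T_L T_R and any family (μ_N) of weak steady states
whose polynomial site moments are bounded uniformly in N and in the site, if for some ε > 0
frequently (in N) |∫ p_0² dμ_{N+1} − T_L| ≥ ε, then there is a tempered weak-stationary state ν of
the half-line system with bath T_L at site 0 (same encoding as in SingleThermostatNoFlux) with |∫
p_0² dν − T_L| ≥ ε. Proof sketch: push μ_{N+1} forward to (ℝ²)^ℕ by zero-padding; uniform second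
moments ⇒ tightness in the product topology of the Polish space ℕ → ℝ × ℝ; Prokhorov ⇒ a weakly
convergent subsequence along the frequent set; moments pass to the limit by Fatou (ν tempered), ∫
p_0² by uniform integrability (4th moments); stationarity: for a cylinder test g on sites 0..k and
N+1 ≥ k+2, generator (N+1) T_L T_R (g∘proj) = [window generator (k+2) T_L T_L of g] ∘ proj (right
bath acts beyond site k), a continuous function of sites 0..k+1 vanishing off supp g × ℝ² and
O(|q_{k+1}|³) there, hence uniformly integrable; and ∫ generator(g∘proj) dμ_{N+1} = 0 although
g∘proj is not compactly supported, by the c -/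
@[route_item "route-AtomisticToContinuum-SingleThermostatRigidity"]
def HalfLineLimit : Prop :=
  ∀ (ω₂ lam β γ T_L T_R : ℝ) (μ : (N : ℕ) → MeasureTheory.Measure (Literature.MathematicalPhysics.KineticTheory.HeatConduction.PhaseSpace N)), (∀ N, (Literature.MathematicalPhysics.KineticTheory.HeatConduction.pinnedChain ω₂ lam β γ).IsSteadyState N T_L T_R (μ N)) → (∀ m : ℕ, ∃ C : ℝ, ∀ (N : ℕ) (i : Fin N), MeasureTheory.Integrable (fun x => |x.1 i| ^ m + |x.2 i| ^ m) (μ N) ∧ ∫ x, (|x.1 i| ^ m + |x.2 i| ^ m) ∂(μ N) ≤ C) → ∀ ε : ℝ, 0 < ε → (∃ᶠ N in Filter.atTop, ε ≤ |∫ x, (x.2 (0 : Fin (N + 1))) ^ 2 ∂(μ (N + 1)) - T_L|) → ∃ ν : MeasureTheory.Measure (ℕ → ℝ × ℝ), (MeasureTheory.IsProbabilityMeasure ν ∧ ∀ (k : ℕ) (g : Literature.MathematicalPhysics.KineticTheory.HeatConduction.PhaseSpace (k + 1) → ℝ), ContDiff ℝ ((⊤ : ℕ∞) : WithTop ℕ∞)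 g → HasCompactSupport g → ∫ σ, (Literature.MathematicalPhysics.KineticTheory.HeatConduction.pinnedChain ω₂ lam β γ).generator (k + 2) T_L T_L (fun y => g (fun i => y.1 (Fin.castSucc i), fun i => y.2 (Fin.castSucc i))) (fun i => (σ (i : ℕ)).1, fun i => (σ (i : ℕ)).2) ∂ν = 0) ∧ (∀ m : ℕ, ∃ C : ℝ, ∀ k : ℕ, MeasureTheory.Integrable (fun σ => |(σ k).1| ^ m + |(σ k).2| ^ m) ν ∧ ∫ σ, (|(σ k).1| ^ m + |(σ k).2| ^ m) ∂ν ≤ C) ∧ ε ≤ |∫ σ, (σ 0).2 ^ 2 ∂ν - T_L|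

/-- item stmt-AtomisticToContinuum-3259 · support · rank 9 · closed · moot by None · by planner
sources: BonettoLebowitzReyBellet2000
[support] EXACT ENERGY BALANCE AT THE TWO CONTACTS (provable; any real parameters and temperatures):
for the (N+2)-site chain and a weak steady state μ all of whose polynomial coordinate moments are
finite, totalCurrent μ = (N+1)·γ·(T_L − ∫ p_0² dμ) = (N+1)·γ·(∫ p_{N+1}² dμ − T_R). Content: with
cutoffs as in HalfLineLimit, 0 = ∫ L(p_0²/2 + U(q_0)) dμ = ⟨p_0 V′(q_1 − q_0)⟩ + γ(T_L − ⟨p_0²⟩)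
(∂_{q_0}H = U′(q_0) − V′(q_1 − q_0)); 0 = ∫ L V(q_1 − q_0) dμ = ⟨(p_1 − p_0)V′(q_1 − q_0)⟩, so ⟨j_0⟩
= −½⟨(p_0 + p_1)V′⟩ = γ(T_L − ⟨p_0²⟩); the window energies H_k give ⟨j_k⟩ = ⟨j_0⟩ for every bond k ≤
N, the last index carries no bond (bondCurrent = 0), hence totalCurrent = (N+1)J̃; and 0 = ∫ L H dμ
= γ(T_L − ⟨p_0²⟩) + γ(T_R − ⟨p²_{N+1}⟩) (generator_hamiltonian) gives the right-end form. This is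
BLR's J̃ = γ(T_L − ⟨p_0²⟩) (BonettoLebowitzReyBellet2000 §5.2 (25)–(27)); it converts NoFlux-type
information into J̃_N → 0 and right-end thermalisation without any reflection argument. -/
@[route_item "route-AtomisticToContinuum-SingleThermostatRigidity"]
def ExactBalance : Prop :=
  ∀ (ω₂ lam β γ T_L T_R : ℝ) (N : ℕ) (μ : MeasureTheory.Measure (Literature.MathematicalPhysics.KineticTheory.HeatConduction.PhaseSpace (N + 2))), (Literature.MathematicalPhysics.KineticTheory.HeatConduction.pinnedChain ω₂ lam β γ).IsSteadyState (N + 2) T_L T_R μ → (∀ (m : ℕ) (i : Fin (N + 2)), MeasureTheory.Integrable (fun x => |x.1 i| ^ m + |x.2 i| ^ m) μ) → (Literature.MathematicalPhysics.KineticTheory.HeatConduction.pinnedChain ω₂ lam β γ).totalCurrent μ = (N + 1) * (γ * (T_L - ∫ x, (x.2 0) ^ 2 ∂μ)) ∧ (Literature.MathematicalPhysics.KineticTheory.HeatConduction.pinnedChain ω₂ lam β γ).totalCurrent μ = (N + 1) * (γ * (∫ x, (x.2 (Fin.last (N + 1))) ^ 2 ∂μ - T_R))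

/-- item stmt-AtomisticToContinuum-3260 · support · rank 9 · closed · moot by None · by planner
sources: SpohnLebowitz1977, RiederLebowitzLieb1967, Nakazawa1970, Dhar2008
[support] CALIBRATION / NEGATIVE-SIDE INSTRUMENT (provable): for the HARMONIC member pinnedChain ω₂
0 0 γ (ω₂, γ, T > 0) there EXISTS a tempered weak-stationary state of the half-line system with one
bath at T whose contact kinetic temperature differs from T (∫ p_0² dν ≠ T): a radiating state. Route
to a proof inside the tree: take T_L = T, T_R = T/2 and the Gaussian steady states harmonicNESS
(isSteadyState_harmonicNESS, HarmonicChainNESS.lean); their covariances are bounded uniformly in N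
(chainCov, HarmonicChainCovariance/Flux.lean) so all Gaussian moments are N- and site-uniform; by
ExactBalance and HarmonicChainBallisticFlux_holds, ∫ p_0² dμ_N = T − c_N·(T/2)/γ with c_N → c_∞ > 0,
so frequently |∫ p_0² − T| ≥ c_∞T/(8γ); HalfLineLimit then yields ν. Classical content:
current-carrying stationary states of infinite harmonic systems (SpohnLebowitz1977;
Dudnikova–Komech–Spohn doi:10.1063/1.1571658). Shows that NoFlux is genuinely anharmonic and that
temperedness alone never excludes currents — the refuter's template for attacking NoFlux. -/
@[route_item "route-AtomisticToContinuum-SingleThermostatRigidity"]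
def HarmonicRadiatingState : Prop :=
  ∀ ω₂ γ T : ℝ, 0 < ω₂ → 0 < γ → 0 < T → ∃ ν : MeasureTheory.Measure (ℕ → ℝ × ℝ), (MeasureTheory.IsProbabilityMeasure ν ∧ ∀ (k : ℕ) (g : Literature.MathematicalPhysics.KineticTheory.HeatConduction.PhaseSpace (k + 1) → ℝ), ContDiff ℝ ((⊤ : ℕ∞) : WithTop ℕ∞) g → HasCompactSupport g → ∫ σ, (Literature.MathematicalPhysics.KineticTheory.HeatConduction.pinnedChain ω₂ 0 0 γ).generator (k + 2) T T (fun y => g (fun i => y.1 (Fin.castSucc i), fun i => y.2 (Fin.castSucc i))) (fun i => (σ (i : ℕ)).1, fun i => (σ (i : ℕ)).2) ∂ν = 0) ∧ (∀ m : ℕ, ∃ C : ℝ, ∀ k : ℕ, MeasureTheory.Integrable (fun σ => |(σ k).1| ^ m + |(σ k).2| ^ m) ν ∧ ∫ σ, (|(σ k).1| ^ m + |(σ k).2| ^ m) ∂ν ≤ C) ∧ ∫ σ, (σ 0).2 ^ 2 ∂ν ≠ T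

/-- item stmt-AtomisticToContinuum-3261 · support · rank 9 · closed · moot by None · by planner
sources: Fritz1986, FritzFunakiLebowitz1994, Liggett2005
[support] THE STRONGER EXPECTED FORM (not load-bearing for the Assembly; filed so that partial
progress has a home): under the hypotheses of SingleThermostatNoFlux, EVERY momentum marginal of ν
is the Maxwellian at the bath temperature: ν ∘ (σ ↦ p_k)⁻¹ = gaussianReal 0 T for all k — 'a single
thermostat thermalises the whole half-infinite anharmonic crystal (kinetically)'. Implies NoFlux (k
= 0, second moment). The full Liouville statement of the card (ν = the DLR Gibbs state of the
half-line Hamiltonian at T, unique in 1-D) is the natural end point; it is not typed here to avoid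
committing to a half-line Gibbs specification before a grounder checks the conventions
(Literature.Probability.LatticeModels.gibbsSpecOfPotential on ℕ would do). With Maxwellian,
site-wise reflection-symmetric momenta, FritzFunakiLebowitz1994 Thm 2.1–2.2-type arguments (local
stability + exchangeability) are the printed road from here to Gibbs, in the translation-invariant
setting only. -/
@[route_item "route-AtomisticToContinuum-SingleThermostatRigidity"]
def SingleThermostatThermalises : Prop :=
  ∀ ω₂ lam β γ : ℝ, 0 < ω₂ → 0 < lam → 0 < β → 0 < γ → ∀ T : ℝ, 0 < T → ∀ ν : MeasureTheory.Measure (ℕ → ℝ × ℝ), (MeasureTheory.IsProbabilityMeasure ν ∧ ∀ (k : ℕ) (g : Literature.MathematicalPhysics.KineticTheory.HeatConduction.PhaseSpace (k + 1) → ℝ), ContDiff ℝ ((⊤ : ℕ∞) : WithTop ℕ∞) g → HasCompactSupport g → ∫ σ, (Literature.MathematicalPhysics.KineticTheory.HeatConduction.pinnedChain ω₂ lam β γ).generator (k + 2) T T (fun y => g (fun i => y.1 (Fin.castSucc i), fun i => y.2 (Fin.castSucc i))) (fun i => (σ (i : ℕ)).1, fun i => (σ (i : ℕ)).2) ∂ν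 = 0) → (∀ m : ℕ, ∃ C : ℝ, ∀ k : ℕ, MeasureTheory.Integrable (fun σ => |(σ k).1| ^ m + |(σ k).2| ^ m) ν ∧ ∫ σ, (|(σ k).1| ^ m + |(σ k).2| ^ m) ∂ν ≤ C) → ∀ k : ℕ, ν.map (fun σ => (σ k).2) = ProbabilityTheory.gaussianReal 0 (Real.toNNReal T)

/-- item stmt-AtomisticToContinuum-3262 · assembly · rank 1 · closed · moot by None · by planner
[assembly] NessTightness → HalfLineLimit → SingleThermostatNoFlux → ExactBalance →
BoundaryThermalisation. Glue (real analysis, ~40 lines): fix parameters > 0, T_L, T_R > 0 and a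
steady family μ; a_N := ∫ p_0² dμ_{N+1}. If a_N ↛ T_L then ∃ ε > 0 with ∃ᶠ N, ε ≤ |a_N − T_L|;
NessTightness supplies the moment hypothesis of HalfLineLimit for this family, which yields a
tempered half-line steady ν at T_L with ε ≤ |∫ p_0² dν − T_L|, contradicting SingleThermostatNoFlux
(∫ p_0² dν = T_L). Hence a_N → T_L. ExactBalance (moments again from NessTightness) gives
totalCurrent(μ_{N+2})/(N+1) = γ(T_L − a_{N+1}) → 0 and ∫ p²_{last} dμ_{N+2} = T_R + (T_L − a_{N+1})
→ T_R; reindex (Filter.tendsto_add_atTop_iff_nat) to the three clauses of BoundaryThermalisation. -/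
@[route_item "route-AtomisticToContinuum-SingleThermostatRigidity"]
def Assembly : Prop :=
  NessTightness → HalfLineLimit → SingleThermostatNoFlux → ExactBalance → BoundaryThermalisation

end Summit.AtomisticToContinuum.FouriersLaw.Theses.SingleThermostatRigidity
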